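import Mathlib
import Literature.AlgebraicGeometry.Resolution.CobordantGame
import Literature.AlgebraicGeometry.Resolution.CobordantChartCoefficients
import Literature.AlgebraicGeometry.Resolution.FormalCoordinateChange
import Summits.ResolutionOfSingularities.ResolutionOfSingularities.Theorems.WeightedInvariantLocalWeightedDropWildMonicTerminalExit
import Summits.ResolutionOfSingularities.ResolutionOfSingularities.Theorems.WeightedInvariantLocalWeightedDropWildMonicTerminalSR

/-!
# `WeightedInvariant.LocalWeightedDrop`, line `hasse-ridge-face-selection`: the SUCCESSOR DISPATCH of the monomial terminal
# class (position again / order drop / order-`d` non-wide exit) and the transport of the vertex test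

Crux item stmt-ResolutionOfSingularities-8899 `LocalWeightedDrop` (route `ResolutionOfSingularities/WeightedInvariant`), engine of
the door `HypersurfaceCentreConstruction` stmt-ResolutionOfSingularities-19897.  [OURS · L1 W4.3, chain w43, res-type-083 (extra
seat S3ρ, CHAIN v4.3 D12): §1 (T) of `L/res-type-083/S3RHO-DESIGN.md`.  Not a statement of any manuscript.]

A tuple `A` is in the MONOMIAL CLASS with data `(N, a, b)` when (M1) every monomial `x^β` of `A_j` has `N β ≥ (d-j)(a,b)`
componentwise, (M2) some coefficient sits at the scaled vertex `(d-j₀)(a,b)/N`, (M3) for an integral vertex (`N ∣ a`, `N ∣ b`) the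
vertex polynomial `Y^d + Σ τ_j Y^j` is no `(Y - μ)^d`.  `won_succ_of_termMono`: a singular monic successor in the class with
`a + b` SMALLER than the current rank is won — it is a position again when `a + b > N` (induction hypothesis), of order `< d` when
`a + b < N` (exit to the germs of smaller order), and of order `d` with a non-wide apex when `a + b = N`
(`WildMonic.not_wide_of_vertex_one`, exit `WildPurePower.won_of_order_eq_of_not_wide`).  `vertexTest_transport`: (M3) is
transported along `τ'_j = c^{(d-j)n} τ_j`.
-/

set_option linter.dupNamespace false -- mandated namespace of this single-conjunct summit

namespace Summit.ResolutionOfSingularities.ResolutionOfSingularities.Theorems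

open Literature.AlgebraicGeometry.Resolution
open Literature.AlgebraicGeometry.Resolution.CobordantGame

namespace WildMonic

open MvPowerSeries

variable {k : Type} [Field k]

/-- THE VERTEX TEST IS TRANSPORTED along a rescaling `τ'_j = c^{(d-j)n} · τ_j` (`c ≠ 0`) of the vertex coefficients. -/
theorem vertexTest_transport {d : ℕ} {c : k} (hc : c ≠ 0) (n : ℕ) (τ τ' : Fin d → k)
    (h : ∀ j : Fin d, τ' j = c ^ ((d - (j : ℕ)) * n) * τ j)
    (hτ : ∀ μ : k, ∃ j : Fin d, τ j ≠ (d.choose (j : ℕ) : k) * (-μ) ^ (d - (j : ℕ))) :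
    ∀ μ' : k, ∃ j : Fin d, τ' j ≠ (d.choose (j : ℕ) : k) * (-μ') ^ (d - (j : ℕ)) := by
  intro μ'
  obtain ⟨j, hj⟩ := hτ (μ' / c ^ n)
  refine ⟨j, fun heq => hj ?_⟩
  rw [h j, pow_mul', mul_comm] at heq
  have hcn : (c ^ n) ^ (d - (j : ℕ)) ≠ 0 := pow_ne_zero _ (pow_ne_zero _ hc)
  rw [show -(μ' / c ^ n) = (-μ') / c ^ n by ring, div_pow, mul_div_assoc', eq_div_iff hcn]
  exact heq

/-- In the monomial class with `a + b > N` the tuple is a POSITION (`ord A_j > d - j`). -/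
theorem isPos_of_termMono {d : ℕ} (N a b : ℕ) (hab : N < a + b) (A : Fin d → MvPowerSeries (Fin 2) k)
    (hM1 : ∀ (j : Fin d) (β : Fin 2 →₀ ℕ), coeff β (A j) ≠ 0 → (d - (j : ℕ)) * a ≤ N * β 0 ∧ (d - (j : ℕ)) * b ≤ N * β 1) :
    ∀ j : Fin d, ((d - (j : ℕ) : ℕ) : ℕ∞) < (A j).order := by
  intro j
  refine lt_of_lt_of_le (by exact_mod_cast Nat.lt_succ_self _) (nat_le_order fun β hβ => ?_)
  by_contra hne
  obtain ⟨h0, h1⟩ := hM1 j β hne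
  rw [degree_fin_two] at hβ
  have hj := j.2
  have hsum : (d - (j : ℕ)) * (a + b) ≤ N * (β 0 + β 1) := by nlinarith
  have h2 : (d - (j : ℕ)) * N < (d - (j : ℕ)) * (a + b) := Nat.mul_lt_mul_of_pos_left hab (by omega)
  have h3 : N * (d - (j : ℕ)) < N * (β 0 + β 1) := by
    rw [Nat.mul_comm N (d - (j : ℕ))]; exact lt_of_lt_of_le h2 hsum
  have := Nat.lt_of_mul_lt_mul_left h3
  omega

/-- In the monomial class with `a + b < N` the monic form has order `< d` (the vertex coefficient is a small monomial). -/
theorem order_lt_of_termMono {d : ℕ} (N a b : ℕ) (hab : a + b < N) (A : Fin d → MvPowerSeries (Fin 2) k)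
    (hM2 : ∃ (j₀ : Fin d) (β : Fin 2 →₀ ℕ), N * β 0 = (d - (j₀ : ℕ)) * a ∧ N * β 1 = (d - (j₀ : ℕ)) * b ∧
      coeff β (A j₀) ≠ 0) :
    ((X (Fin.last 2) : MvPowerSeries (Fin (2 + 1)) k) ^ d +
      ∑ j : Fin d, rename (Fin.succAboveEmb (Fin.last 2)) (A j) * X (Fin.last 2) ^ (j : ℕ)).order < d := by
  obtain ⟨j₀, β, h0, h1, hne⟩ := hM2
  refine lt_of_le_of_lt (order_monicForm_le_of_coeff A j₀ β hne) ?_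
  have hj := j₀.2
  have hdeg : β.degree = β 0 + β 1 := degree_fin_two β
  have h2 : (d - (j₀ : ℕ)) * (a + b) < (d - (j₀ : ℕ)) * N := Nat.mul_lt_mul_of_pos_left hab (by omega)
  have hlt : N * (β 0 + β 1) < N * (d - (j₀ : ℕ)) := by
    rw [Nat.mul_add, h0, h1, ← Nat.mul_add, Nat.mul_comm N]; exact h2
  have := Nat.lt_of_mul_lt_mul_left hlt
  exact_mod_cast (by omega : β.degree + (j₀ : ℕ) < d)

/-- THE SUCCESSOR DISPATCH of the monomial class (see the module docstring). -/
theorem won_succ_of_termMono (p : ℕ) (hp : p.Prime) (k : Type) [Field k] [CharP k p] [IsAlgClosed k] {d : ℕ} (hd : 0 < d)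
    (hord : ∀ g : MvPowerSeries (Fin 3) k, CobordantGame.IsSingular k g → g.order < d → CobordantGame.Won k 3 g)
    (haxis : ∀ g : MvPowerSeries (Fin 3) k, CobordantGame.IsSingular k g → g.order = d →
      (∃ c : Fin 3 → k, c ≠ 0 ∧ ∀ v : Fin 3 → k,
        CobordantChart.initEval (fun _ : Fin 3 => 1) (v + c) d g = CobordantChart.initEval (fun _ : Fin 3 => 1) v d g) →
      (∀ c₁ c₂ : Fin 3 → k,
        (∀ v : Fin 3 → k, CobordantChart.initEval (fun _ : Fin 3 => 1) (v + c₁) d g =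
          CobordantChart.initEval (fun _ : Fin 3 => 1) v d g) →
        (∀ v : Fin 3 → k, CobordantChart.initEval (fun _ : Fin 3 => 1) (v + c₂) d g =
          CobordantChart.initEval (fun _ : Fin 3 => 1) v d g) →
        ∃ α β : k, (α ≠ 0 ∨ β ≠ 0) ∧ α • c₁ + β • c₂ = 0) →
      CobordantGame.Won k 3 g)
    (N : ℕ) (hN : 0 < N) (r : ℕ)
    (ih : ∀ a b : ℕ, a + b < r → ∀ A : Fin d → MvPowerSeries (Fin 2) k,
      (∀ j : Fin d, ((d - (j : ℕ) : ℕ) : ℕ∞) < (A j).order) →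
      (∀ (j : Fin d) (β : Fin 2 →₀ ℕ), coeff β (A j) ≠ 0 → (d - (j : ℕ)) * a ≤ N * β 0 ∧ (d - (j : ℕ)) * b ≤ N * β 1) →
      (∃ (j₀ : Fin d) (β : Fin 2 →₀ ℕ), N * β 0 = (d - (j₀ : ℕ)) * a ∧ N * β 1 = (d - (j₀ : ℕ)) * b ∧ coeff β (A j₀) ≠ 0) →
      (N ∣ a → N ∣ b → ∀ μ : k, ∃ j : Fin d,
        coeff (Finsupp.single 0 ((d - (j : ℕ)) * a / N) + Finsupp.single 1 ((d - (j : ℕ)) * b / N)) (A j) ≠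
          (d.choose (j : ℕ) : k) * (-μ) ^ (d - (j : ℕ))) →
      CobordantGame.Won k (2 + 1) ((X (Fin.last 2) : MvPowerSeries (Fin (2 + 1)) k) ^ d +
        ∑ j : Fin d, rename (Fin.succAboveEmb (Fin.last 2)) (A j) * X (Fin.last 2) ^ (j : ℕ)))
    (a b : ℕ) (hlt : a + b < r) (A : Fin d → MvPowerSeries (Fin 2) k)
    (hM1 : ∀ (j : Fin d) (β : Fin 2 →₀ ℕ), coeff β (A j) ≠ 0 → (d - (j : ℕ)) * a ≤ N * β 0 ∧ (d - (j : ℕ)) * b ≤ N * β 1)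
    (hM2 : ∃ (j₀ : Fin d) (β : Fin 2 →₀ ℕ), N * β 0 = (d - (j₀ : ℕ)) * a ∧ N * β 1 = (d - (j₀ : ℕ)) * b ∧ coeff β (A j₀) ≠ 0)
    (hM3 : N ∣ a → N ∣ b → ∀ μ : k, ∃ j : Fin d,
      coeff (Finsupp.single 0 ((d - (j : ℕ)) * a / N) + Finsupp.single 1 ((d - (j : ℕ)) * b / N)) (A j) ≠
        (d.choose (j : ℕ) : k) * (-μ) ^ (d - (j : ℕ)))
    (hSs : CobordantGame.IsSingular k ((X (Fin.last 2) : MvPowerSeries (Fin (2 + 1)) k) ^ d +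
      ∑ j : Fin d, rename (Fin.succAboveEmb (Fin.last 2)) (A j) * X (Fin.last 2) ^ (j : ℕ))) :
    CobordantGame.Won k (2 + 1) ((X (Fin.last 2) : MvPowerSeries (Fin (2 + 1)) k) ^ d +
      ∑ j : Fin d, rename (Fin.succAboveEmb (Fin.last 2)) (A j) * X (Fin.last 2) ^ (j : ℕ)) := by
  rcases Nat.lt_trichotomy (a + b) N with hsm | heq | hgt
  · -- order drop
    exact hord _ hSs (order_lt_of_termMono N a b hsm A hM2)
  · -- order `d`, not wide
    have hSo : ((X (Fin.last 2) : MvPowerSeries (Fin (2 + 1)) k) ^ d +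
        ∑ j : Fin d, rename (Fin.succAboveEmb (Fin.last 2)) (A j) * X (Fin.last 2) ^ (j : ℕ)).order = d := by
      refine le_antisymm (order_monicForm_le A) (le_order_monicForm_of_support A fun j β hβ => ?_)
      obtain ⟨h0, h1⟩ := hM1 j β hβ
      rw [degree_fin_two]
      have h : N * (d - (j : ℕ)) ≤ N * (β 0 + β 1) := by
        have := Nat.add_le_add h0 h1
        rw [← Nat.mul_add, heq, Nat.mul_comm] at this
        rw [Nat.mul_add]; exact this
      exact Nat.le_of_mul_le_mul_left h hN
    exact WildPurePower.won_of_order_eq_of_not_wide p hp k hord haxis _ hSs hSo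
      (not_wide_of_vertex_one k hd N a b hN heq A hM1 hM2 hM3)
  · -- a position again: induction hypothesis
    exact ih a b hlt A (isPos_of_termMono N a b hgt A hM1) hM1 hM2 hM3

end WildMonic

end Summit.ResolutionOfSingularities.ResolutionOfSingularities.Theorems
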